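import Literature.NumberTheory.Transcendental.KZSliceFubini

/-!
# `DihedralNormalForm` (stmt-KontsevichZagierPeriods-3912): negative side — two-coordinate slices and Newton–Leibniz on raw band data

Part 1/4 of the certified proof that rule (2) (change of variables) is load-bearing for the crux
`DihedralNormalForm` (work file `Cruxes/DihedralNormalForm/Disproof.lean`, §9).  Infrastructure:

* `cons2 : (ℝ × ℝ) × ℝᵐ → ℝᵐ⁺²`, `((s,t),x) ↦ (s,t,x)`, as a measurable equivalence
  (`cons2Equiv`), measure preserving (`measurePreserving_cons2`); two-coordinate Fubini
  (`integral_integral_slice2`), a.e. integrable slices (`ae_integrable_slice2`), a.e. null slices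
  (`ae_volume_slice2_eq_zero`) — the two-coordinate analogue of `KZSliceFubini.lean`;
* structural identities (`init_cons2`, `cons2_apply_last`, `cons2_snoc`);
* `integral_band_eq` — Fubini + the fundamental theorem of calculus on a band
  `{(x,t) | x ∈ τ, a x ≤ t ≤ b x}` for RAW measurable data (the computation of
  `KZ.eval_eq_zero_of_mem_newtonLeibnizRel_holds` with semialgebraicity replaced by measurability),
  so that it applies to real-parameter slices of Newton–Leibniz instances.

[Kontsevich–Zagier 2001, §1.2 rule (3)] -/

noncomputable section

open MeasureTheory Set Filter
open Literature.NumberTheory.Transcendental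

namespace Summit.KontsevichZagierPeriods.DihedralNormalForm.Negative

variable {m : ℕ}

/-- The double cons `((s,t),x) ↦ (s,t,x) : (ℝ × ℝ) × ℝᵐ → ℝᵐ⁺²`. -/
def cons2 (p : (ℝ × ℝ) × (Fin m → ℝ)) : Fin (m + 2) → ℝ :=
  Matrix.vecCons p.1.1 (Matrix.vecCons p.1.2 p.2)

/-- `cons2` as a measurable equivalence. -/
def cons2Equiv : (ℝ × ℝ) × (Fin m → ℝ) ≃ᵐ (Fin (m + 2) → ℝ) :=
  MeasurableEquiv.prodAssoc.trans
    ((MeasurableEquiv.prodCongr (MeasurableEquiv.refl ℝ)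
      (MeasurableEquiv.piFinSuccAbove (fun _ : Fin (m + 1) => ℝ) 0).symm).trans
      (MeasurableEquiv.piFinSuccAbove (fun _ : Fin (m + 2) => ℝ) 0).symm)

/-- `cons2Equiv` is `cons2` pointwise. [folklore] -/
theorem cons2Equiv_apply (p : (ℝ × ℝ) × (Fin m → ℝ)) : cons2Equiv p = cons2 p := by
  have h1 : ∀ q : ℝ × (Fin (m + 1) → ℝ),
      (MeasurableEquiv.piFinSuccAbove (fun _ : Fin (m + 2) => ℝ) 0).symm q =
        Matrix.vecCons q.1 q.2 := KZ.piFinSuccAbove_zero_symm_apply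
  have h2 : ∀ q : ℝ × (Fin m → ℝ),
      (MeasurableEquiv.piFinSuccAbove (fun _ : Fin (m + 1) => ℝ) 0).symm q =
        Matrix.vecCons q.1 q.2 := KZ.piFinSuccAbove_zero_symm_apply
  show (MeasurableEquiv.piFinSuccAbove (fun _ : Fin (m + 2) => ℝ) 0).symm
      (MeasurableEquiv.prodCongr (MeasurableEquiv.refl ℝ)
        (MeasurableEquiv.piFinSuccAbove (fun _ : Fin (m + 1) => ℝ) 0).symm
        (MeasurableEquiv.prodAssoc p)) = cons2 p
  rw [h1]
  simp only [MeasurableEquiv.prodCongr, MeasurableEquiv.coe_mk, Equiv.prodCongr_apply,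
    MeasurableEquiv.prodAssoc, Equiv.prodAssoc_apply, Prod.map_fst, Prod.map_snd, cons2]
  congr 1
  exact h2 _

/-- `cons2Equiv` is `cons2` as a function. [folklore] -/
theorem coe_cons2Equiv : ⇑(cons2Equiv (m := m)) = cons2 := funext cons2Equiv_apply

/-- `cons2` is a measurable embedding. [folklore] -/
theorem measurableEmbedding_cons2 : MeasurableEmbedding (cons2 (m := m)) := by
  rw [← coe_cons2Equiv]
  exact cons2Equiv.measurableEmbedding

/-- `cons2` is measure preserving from `(vol × vol) × vol` to Lebesgue measure on `ℝᵐ⁺²`. [folklore] -/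
theorem measurePreserving_cons2 :
    MeasurePreserving (cons2 (m := m))
      (((volume : Measure ℝ).prod (volume : Measure ℝ)).prod (volume : Measure (Fin m → ℝ)))
      volume := by
  have h1 : MeasurePreserving (MeasurableEquiv.prodAssoc : (ℝ × ℝ) × (Fin m → ℝ) ≃ᵐ _)
      (((volume : Measure ℝ).prod (volume : Measure ℝ)).prod volume)
      ((volume : Measure ℝ).prod ((volume : Measure ℝ).prod volume)) :=
    measurePreserving_prodAssoc volume volume volume
  have h2 : MeasurePreserving
      (Prod.map id fun q : ℝ × (Fin m → ℝ) => Matrix.vecCons q.1 q.2)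
      ((volume : Measure ℝ).prod ((volume : Measure ℝ).prod volume))
      ((volume : Measure ℝ).prod (volume : Measure (Fin (m + 1) → ℝ))) :=
    (MeasurePreserving.id volume).prod KZ.measurePreserving_vecCons
  have h3 := (KZ.measurePreserving_vecCons (n := m + 1)).comp (h2.comp h1)
  convert h3 using 1
  funext p
  simp [cons2, MeasurableEquiv.prodAssoc, Equiv.prodAssoc]

/-- A measurable-equivalence change of variables: integrability transfers to `cons2`. [folklore] -/
theorem integrable_comp_cons2 {G : (Fin (m + 2) → ℝ) → ℝ} (hG : Integrable G) :
    Integrable (fun p : (ℝ × ℝ) × (Fin m → ℝ) => G (cons2 p))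
      (((volume : Measure ℝ).prod (volume : Measure ℝ)).prod volume) :=
  (measurePreserving_cons2.integrable_comp_emb measurableEmbedding_cons2).mpr hG

/-- Almost every two-coordinate slice of an integrable function is integrable. [folklore] -/
theorem ae_integrable_slice2 {G : (Fin (m + 2) → ℝ) → ℝ} (hG : Integrable G) :
    ∀ᵐ q : ℝ × ℝ, Integrable fun x : Fin m → ℝ => G (cons2 (q, x)) := by
  rw [Measure.volume_eq_prod]
  exact (integrable_comp_cons2 hG).prod_right_ae

/-- The two-coordinate slice integrals form an integrable function of the two coordinates.
[folklore] -/
theorem integrable_integral_slice2 {G : (Fin (m + 2) → ℝ) → ℝ} (hG : Integrable G) :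
    Integrable fun q : ℝ × ℝ => ∫ x : Fin m → ℝ, G (cons2 (q, x)) := by
  rw [Measure.volume_eq_prod]
  exact (integrable_comp_cons2 hG).integral_prod_left

/-- Almost every two-coordinate slice of a null set is null. [folklore] -/
theorem ae_volume_slice2_eq_zero {N : Set (Fin (m + 2) → ℝ)} (hN : volume N = 0) :
    ∀ᵐ q : ℝ × ℝ, volume {x : Fin m → ℝ | cons2 (q, x) ∈ N} = 0 := by
  have h : (((volume : Measure ℝ).prod (volume : Measure ℝ)).prod (volume : Measure (Fin m → ℝ)))
      (cons2 ⁻¹' N) = 0 :=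
    (measurePreserving_cons2.measure_preimage (NullMeasurableSet.of_null hN)).trans hN
  rw [Measure.volume_eq_prod]
  filter_upwards [Measure.measure_ae_null_of_prod_null h] with q hq
  exact hq

/-- Two-coordinate Fubini: the slice integrals integrate to the total integral. [folklore] -/
theorem integral_integral_slice2 {G : (Fin (m + 2) → ℝ) → ℝ} (hG : Integrable G) :
    ∫ q : ℝ × ℝ, ∫ x : Fin m → ℝ, G (cons2 (q, x)) = ∫ z, G z := by
  have h := integral_prod (fun p : (ℝ × ℝ) × (Fin m → ℝ) => G (cons2 p)) (integrable_comp_cons2 hG)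
  rw [Measure.volume_eq_prod, ← h]
  exact measurePreserving_cons2.integral_comp measurableEmbedding_cons2 G

/-! ### Structural identities for `cons2` -/

/-- Unfolding `cons2`. [folklore] -/
theorem cons2_mk (q : ℝ × ℝ) (x : Fin m → ℝ) :
    cons2 (q, x) = Matrix.vecCons q.1 (Matrix.vecCons q.2 x) := rfl

/-- `init` commutes with `cons2`. [folklore] -/
theorem init_cons2 (q : ℝ × ℝ) (z : Fin (m + 1) → ℝ) :
    Fin.init (cons2 (q, z)) = cons2 (q, Fin.init z) := by
  ext j
  simp only [cons2, Fin.init]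
  refine Fin.cases ?_ (fun i => ?_) j
  · simp
  · refine Fin.cases ?_ (fun i' => ?_) i
    · simp
    · have e1 : (Fin.castSucc (Fin.succ (Fin.succ i')) : Fin (m + 3)) =
          Fin.succ (Fin.succ (Fin.castSucc i')) := rfl
      rw [e1]
      simp [Matrix.vecCons]
      rfl

/-- The last entry of `cons2`. [folklore] -/
theorem cons2_apply_last (q : ℝ × ℝ) (z : Fin (m + 1) → ℝ) :
    cons2 (q, z) (Fin.last (m + 2)) = z (Fin.last m) := by
  simp only [cons2]
  rw [show (Fin.last (m + 2)) = Fin.succ (Fin.succ (Fin.last m)) from rfl]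
  simp [Matrix.vecCons]

/-- `snoc` commutes with `cons2`. [folklore] -/
theorem cons2_snoc (q : ℝ × ℝ) (y : Fin m → ℝ) (w : ℝ) :
    cons2 (q, Fin.snoc y w) = Fin.snoc (cons2 (q, y)) w := by
  simp only [cons2, Matrix.vecCons]
  rw [Fin.cons_snoc_eq_snoc_cons, Fin.cons_snoc_eq_snoc_cons]

/-! ### Newton–Leibniz along the last coordinate for raw measurable data -/

/-- **Fubini + FTC on a band, raw data** (the computation of
`KZ.eval_eq_zero_of_mem_newtonLeibnizRel_holds` with the semialgebraicity fields replaced by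
measurability hypotheses, so that it applies to real-parameter slices). [folklore] -/
theorem integral_band_eq {k : ℕ} {τ : Set (Fin k → ℝ)} (hτm : MeasurableSet τ)
    {a b : (Fin k → ℝ) → ℝ} {F g : (Fin (k + 1) → ℝ) → ℝ} {B : Set (Fin (k + 1) → ℝ)}
    (hbm : MeasurableSet B) (hab : ∀ x ∈ τ, a x ≤ b x)
    (hdom : B = {z | (Fin.init z : Fin k → ℝ) ∈ τ ∧ a (Fin.init z) ≤ z (Fin.last k) ∧
      z (Fin.last k) ≤ b (Fin.init z)})
    (hcont : ∀ x ∈ τ, ContinuousOn (fun t : ℝ => F (Fin.snoc x t)) (Icc (a x) (b x)))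
    (hderiv : ∀ x ∈ τ, ∀ t ∈ Ioo (a x) (b x),
      HasDerivAt (fun s : ℝ => F (Fin.snoc x s)) (g (Fin.snoc x t)) t)
    (hint : IntegrableOn g B) :
    ∫ z in B, g z = ∫ x in τ, (F (Fin.snoc x (b x)) - F (Fin.snoc x (a x))) := by
  set e : (Fin (k + 1) → ℝ) ≃ᵐ ℝ × (Fin k → ℝ) :=
    MeasurableEquiv.piFinSuccAbove (fun _ => ℝ) (Fin.last k) with he_def
  have he : MeasurePreserving e volume volume :=
    volume_preserving_piFinSuccAbove (fun _ => ℝ) (Fin.last k)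
  have he_symm : ∀ p : ℝ × (Fin k → ℝ), e.symm p = Fin.snoc p.2 p.1 := fun p => by
    simp [he_def, MeasurableEquiv.piFinSuccAbove, Fin.snocEquiv]
  have hmem : ∀ x t, Fin.snoc x t ∈ B ↔ x ∈ τ ∧ t ∈ Icc (a x) (b x) := by
    intro x t
    rw [hdom]
    simp only [mem_setOf_eq, Fin.init_snoc, Fin.snoc_last, mem_Icc]
  set G : (Fin (k + 1) → ℝ) → ℝ := B.indicator g with hG_def
  have hG : Integrable G := (integrable_indicator_iff hbm).mpr hint
  have hfib_in : ∀ x ∈ τ, (fun t => G (Fin.snoc x t)) =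
      (Icc (a x) (b x)).indicator (fun t => g (Fin.snoc x t)) := by
    intro x hx
    ext t
    by_cases ht : t ∈ Icc (a x) (b x)
    · rw [Set.indicator_of_mem ht, hG_def, Set.indicator_of_mem ((hmem x t).2 ⟨hx, ht⟩)]
    · rw [Set.indicator_of_notMem ht, hG_def,
        Set.indicator_of_notMem (fun h => ht ((hmem x t).1 h).2)]
  have hfib_out : ∀ x ∉ τ, (fun t => G (Fin.snoc x t)) = fun _ => 0 := by
    intro x hx
    ext t
    rw [hG_def, Set.indicator_of_notMem (fun h => hx ((hmem x t).1 h).1)]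
  have hG2 : Integrable (fun p : ℝ × (Fin k → ℝ) => G (Fin.snoc p.2 p.1))
      ((volume : Measure ℝ).prod (volume : Measure (Fin k → ℝ))) := by
    have h := ((he.symm e).integrable_comp_emb e.symm.measurableEmbedding (g := G)).mpr hG
    rw [← Measure.volume_eq_prod]
    convert h using 1
    ext p
    simp [he_symm]
  calc ∫ z in B, g z
      = ∫ z, G z := (integral_indicator hbm).symm
    _ = ∫ p, G (e.symm p) := ((he.symm e).integral_comp' G).symm
    _ = ∫ p : ℝ × (Fin k → ℝ), G (Fin.snoc p.2 p.1) ∂(volume.prod volume) := by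
        simp_rw [he_symm, Measure.volume_eq_prod]
    _ = ∫ x, ∫ t, G (Fin.snoc x t) := integral_prod_symm _ hG2
    _ = ∫ x, τ.indicator (fun x => F (Fin.snoc x (b x)) - F (Fin.snoc x (a x))) x := by
        apply integral_congr_ae
        filter_upwards [hG2.prod_left_ae] with x hx
        by_cases hxτ : x ∈ τ
        · rw [Set.indicator_of_mem hxτ, hfib_in x hxτ, integral_indicator measurableSet_Icc,
            integral_Icc_eq_integral_Ioc, ← intervalIntegral.integral_of_le (hab x hxτ)]
          apply intervalIntegral.integral_eq_sub_of_hasDerivAt_of_le (hab x hxτ) (hcont x hxτ)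
            (hderiv x hxτ)
          rw [intervalIntegrable_iff_integrableOn_Icc_of_le (hab x hxτ)]
          have hx' : Integrable (fun t => G (Fin.snoc x t)) := hx
          rw [hfib_in x hxτ] at hx'
          exact (integrable_indicator_iff measurableSet_Icc).mp hx'
        · rw [Set.indicator_of_notMem hxτ]
          rw [hfib_out x hxτ, integral_zero]
    _ = ∫ x in τ, (F (Fin.snoc x (b x)) - F (Fin.snoc x (a x))) := integral_indicator hτm

/-- `cons2 (q, ·)` is measurable. [folklore] -/
theorem measurable_cons2_mk (q : ℝ × ℝ) : Measurable fun x : Fin m → ℝ => cons2 (q, x) :=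
  (KZ.measurable_vecCons q.1).comp (KZ.measurable_vecCons q.2)


end Summit.KontsevichZagierPeriods.DihedralNormalForm.Negative
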